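import Literature.NumberTheory.Automorphic.UnitaryLatticeTreeTubeAxisVertex     -- ★ p848332 (this seat): A(M) self-dual, `v_pairing_generator_proj`; brings ★ p848197
import HarnessLib

/-!
# The lattice graph of a hermitian space — THE CONE OVER AN AXIS VERTEX: the LEVEL-`c` TUBE CRITERION for a block operator, the anatomy of a cone member
# (`M ∩ W = {w ∈ A(M) ∩ W ∣ |⟨z, w⟩| ≤ |ϖ|^b}`, `|⟨z,z⟩| = 1`), fixedness and levels of `ι(γ₂, u)` in generator currency, and the value of the glued generator
# (Kottwitz 1986 §3; Bruhat–Tits 1972 §10; Jacobowitz 1962 §4; Rogawski 1990 §4.9)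

Topic `NumberTheory/Automorphic`; namespace `Literature.NumberTheory.Automorphic.UnitaryLatticeTree`.  THEOREMS ONLY (no definition, no instance, no notation, no named fact,
no `sorry`); kernel lane `--supports stmt-HodgeConjecture-24833`; datum-free (`K` with `Valued K ℤᵐ⁰`).  Cell `pub/hodgecm-mathlib`, crux H413; road «S3-ram» (count-neutral),
(T2) G-side organ (Cnt2′) of chair F0P3a-p07 (g14), sub-organ **(z1-c) TUBE LAYERS `b ≥ 1`**, census part (c3) PART I: heads (c3-i), (c3-ii), (c3-iv), (c3-iv′), (c3-v) of
`F0/P3a/F0P2-p01/g16/z1c/UnitaryLatticeTreeTubeCone.statementfirst.v1.F0P2p01g16.lean` (ruling (6) «=»; (c3-iii)(c3-iii′) — the construction∕enumeration of the cone — are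
the sequel).  Over ★ `UnitaryLatticeTreeTubeCoordinate` (p848197) and ★ `UnitaryLatticeTreeTubeAxisVertex` (p848332).  Seat F0P2-p01 (g16).
HONEST LABEL: HC_CM is proved only modulo the 2 remaining named inputs (hLiu418 24832, h413 24833) until rung 0 closes; elementary lattice algebra, no books consequence.

THE MATHEMATICS.  Block currency: `H = !![H₂ 0 0, 0, H₂ 0 1; 0, h, 0; H₂ 1 0, 0, H₂ 1 1]` (`det H₂ ≠ 0`, `|h| = 1`), `W = {x₁ = 0}`, `pr_W x = x − x₁e₁`; a BLOCK operator `S`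
(column `1` = `S₁₁e₁`; for (c3-iv′) also row `1` zero off the diagonal) — the shape of `Γ − u`, `Γ − 1`, `(Γ − 1)²` and their scalings for `Γ = ι(γ₂, u) = endoGL (γ₂, u)`.
`M` has tube coordinate `b` (`c·e₁ ∈ M ⟺ |c| ≤ |ϖ|^b`) and generator `x₀` (`|x₀,₁| = |ϖ|^{−b}`, `M = (M ∩ W) + 𝒪x₀`); `A(M) := (M ∩ W) ⊔ ϖ^b·M ⊔ 𝒪e₁`; `z := ϖ^b·pr_W x₀`.
* (c3-i) **LEVEL-`c` TUBE CRITERION** (`forall_mulVec_mem_scaleLattice_iff_of_tubeCoordinate`; no self-duality): `S·M ⊆ c·M ⟺ |S₁₁| ≤ |c| ∧ S·(M ∩ W) ⊆ c·M ∧ (S − S₁₁)·x₀ ∈ c·M`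
  — ★ TC∕TC′ (`UnitaryLatticeTreeBlockTubeCriterion`) is the case `c = 1`; `S = Γ − 1`, `c = ϖ^e` is `LEV(ϖ^e)`; `S = (Γ − 1)²` is `LEV₂`.
* (c3-ii) **ANATOMY** (`cone_anatomy_of_tubeCoordinate`, `M` self-dual, `b ≥ 1`): `z ∈ A(M)`; `|⟨z, z⟩| = 1` (the residual line of `z` is ANISOTROPIC); `|⟨z,z⟩ + h·N(ϖ^b x₀,₁)| ≤ |ϖ|^{2b}`
  (the glued generator is integrally isotropic); `M ∩ W = {w ∈ A(M) ∩ W ∣ |⟨z, w⟩| ≤ |ϖ|^b}`.  Also `ϖ^b·A(M) ≤ M` (`scaleLattice_axisVertex_le`).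
* (c3-iv′) **LEVELS ON THE CONE** (`forall_mulVec_mem_scaleLattice_iff_of_cone`): `S·M ⊆ c·M ⟺ |S₁₁| ≤ |c| ∧ S·(M ∩ W) ⊆ c·M ∧ (S − S₁₁·1)z ∈ (ϖ^b c)·A(M) ∧ |⟨z, (S − S₁₁·1)z⟩| ≤
  |ϖ|^{2b}|c|`; (c3-iv) **FIXEDNESS** (`mapGL_endoGL_le_iff_of_tubeCoordinate`, `|u| = 1`): `Γ·M ⊆ M ⟺ Γ·(M ∩ W) ⊆ M ∧ (Γ − u·1)z ∈ ϖ^b·A(M) ∧ |⟨z, (Γ − u·1)z⟩| ≤ |ϖ|^{2b}` —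
  the gluing digit never enters (fixed cone members come in full digit fibres).
* (c3-v) **VALUE OF THE GLUED GENERATOR** (`pairing_add_single_endoGL_sub_one`): `⟨z + te₁, (Γ − 1)(z + te₁)⟩ = ⟨z, (Γ − u·1)z⟩ + (u − 1)(⟨z,z⟩ + σ(t)h t)` for `z ∈ W` —
  with ★ `UnitaryLatticeTreeGluedChildValueRamified` (p847504) this reads the class of a tube vertex on `⟨z, (γ₂ − u)z⟩`.

## References
* [Kottwitz1986] R. E. Kottwitz, *Base change for unit elements of Hecke algebras*, Compositio Math. 60 (1986), §3 (fixed lattices of a block element; levels).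
* [BruhatTits1972] F. Bruhat, J. Tits, *Groupes réductifs sur un corps local I*, Publ. Math. IHÉS 41 (1972), §10 (lattice models; vertex stabilisers and their filtrations).
* [Jacobowitz1962] R. Jacobowitz, *Hermitian forms over local fields*, Amer. J. Math. 84 (1962), §4 (dual lattices, gluing).
* [Rogawski1990] J. D. Rogawski, *Automorphic Representations of Unitary Groups in Three Variables*, Ann. of Math. Stud. 123 (1990), §4.8 Case (a) p. 53, §4.9 p. 55.
* [Serre1980Trees] J.-P. Serre, *Trees* (1980), Ch. II §1.1 (lattices, distance from a base lattice).
-/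

set_option autoImplicit false

noncomputable section

open scoped Valued WithZero Matrix MatrixGroups

namespace Literature.NumberTheory.Automorphic.UnitaryLatticeTree

open Literature.NumberTheory.Automorphic Literature.NumberTheory.Automorphic.HermitianLattice Literature.NumberTheory.Rogawski1990

variable {K : Type*} [Field K] [Valued K ℤᵐ⁰]

/-! ## §1 Block bookkeeping -/

omit [Valued K ℤᵐ⁰] in
/-- A block operator maps `c·e₁` to `(S₁₁c)·e₁`. [cite: BruhatTits1972, §10] -/
theorem mulVec_single_one_of_block {S : Matrix (Fin 3) (Fin 3) K} (hcol : ∀ l, l ≠ 1 → S l 1 = 0) (a : K) :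
    S *ᵥ Pi.single 1 a = Pi.single 1 (S 1 1 * a) := by
  ext i
  rcases eq_or_ne i 1 with rfl | hi
  · simp [Matrix.mulVec, dotProduct, Pi.single_apply]
  · simp [Matrix.mulVec, dotProduct, Pi.single_apply, hi, hcol i hi]

omit [Valued K ℤᵐ⁰] in
/-- `(S − S₁₁)·x₀ = (S − S₁₁)·pr_W x₀` for a block operator (the line component cancels). [cite: BruhatTits1972, §10] -/
theorem sub_smul_mulVec_eq_of_block {S : Matrix (Fin 3) (Fin 3) K} (hcol : ∀ l, l ≠ 1 → S l 1 = 0) (x₀ : Fin 3 → K) :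
    S *ᵥ x₀ - S 1 1 • x₀ = S *ᵥ (x₀ - Pi.single 1 (x₀ 1)) - S 1 1 • (x₀ - Pi.single 1 (x₀ 1)) := by
  rw [Matrix.mulVec_sub, mulVec_single_one_of_block hcol, smul_sub]
  have e : (S 1 1 • (Pi.single 1 (x₀ 1) : Fin 3 → K)) = Pi.single 1 (S 1 1 * x₀ 1) := by
    ext k; rcases eq_or_ne k 1 with rfl | hk <;> simp [*]
  rw [e]; abel

omit [Valued K ℤᵐ⁰] in
/-- `(S − S₁₁)·x₀` lies in `W` for a block operator. [cite: BruhatTits1972, §10] -/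
theorem sub_smul_mulVec_apply_one_of_block {S : Matrix (Fin 3) (Fin 3) K} (hrow : ∀ l, l ≠ 1 → S 1 l = 0) (x₀ : Fin 3 → K) :
    (S *ᵥ x₀ - S 1 1 • x₀) 1 = 0 := by
  have h1 : (S *ᵥ x₀) 1 = S 1 1 * x₀ 1 := by
    simp only [Matrix.mulVec, dotProduct, Fin.sum_univ_three]
    rw [hrow 0 (by decide), hrow 2 (by decide)]; ring
  simp [h1]

/-- `ϖ^b·A(M) ≤ M`: the axis vertex is at distance `≤ 2b`. [cite: Serre1980Trees, Ch. II §1.1] -/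
theorem scaleLattice_axisVertex_le {ϖ : K} (hϖ : Valued.v ϖ = WithZero.exp (-1 : ℤ)) {M : Submodule 𝒪[K] (Fin 3 → K)} {b : ℕ}
    (hb : ∀ c : K, (Pi.single 1 c : Fin 3 → K) ∈ M ↔ Valued.v c ≤ Valued.v ϖ ^ b) :
    scaleLattice (ϖ ^ b) (M ⊓ LinearMap.ker ((LinearMap.proj (1 : Fin 3) : (Fin 3 → K) →ₗ[K] K).restrictScalars 𝒪[K]) ⊔ scaleLattice (ϖ ^ b) M ⊔
        Submodule.span 𝒪[K] {(Pi.single 1 1 : Fin 3 → K)}) ≤ M := by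
  have hϖ0' : Valued.v ϖ ≠ 0 := by rw [hϖ]; exact WithZero.exp_ne_zero
  have hϖ0 : ϖ ≠ 0 := fun h0 => by rw [h0, map_zero] at hϖ0'; exact hϖ0' rfl
  have hϖ1 : Valued.v ϖ ≤ 1 := by rw [hϖ, ← WithZero.exp_zero, WithZero.exp_le_exp]; omega
  have hϖb0' : ϖ ^ b ≠ 0 := pow_ne_zero _ hϖ0
  have hϖb1 : Valued.v (ϖ ^ b) ≤ 1 := by rw [map_pow]; exact pow_le_one₀ zero_le hϖ1
  intro x hx
  rw [mem_scaleLattice_iff hϖb0'] at hx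
  obtain ⟨y, hy, l, hl, hxy⟩ := Submodule.mem_sup.1 hx
  obtain ⟨w, hw, s, hs, rfl⟩ := Submodule.mem_sup.1 hy
  obtain ⟨a, rfl⟩ := Submodule.mem_span_singleton.1 hl
  have e : x = (ϖ ^ b) • (w + s) + (ϖ ^ b) • (a • (Pi.single 1 1 : Fin 3 → K)) := by
    rw [← smul_add, hxy, smul_smul, mul_inv_cancel₀ hϖb0', one_smul]
  rw [e]
  refine M.add_mem (smul_mem_of_v_le M hϖb1 (M.add_mem hw.1 (scaleLattice_le_self_of_v_le_one hϖb1 M hs))) ?_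
  have e2 : (ϖ ^ b) • (a • (Pi.single 1 1 : Fin 3 → K)) = Pi.single 1 (ϖ ^ b * (a : K)) := by
    ext k; change (ϖ ^ b • ((a : K) • (Pi.single 1 1 : Fin 3 → K))) k = _
    rcases eq_or_ne k 1 with rfl | hk <;> simp [*]
  rw [e2, hb, map_mul, map_pow]
  exact (mul_le_mul' le_rfl ((mem_integer_iff' _).1 a.2)).trans (le_of_eq (mul_one _))

/-! ## §2 (c3-i) THE LEVEL-`c` TUBE CRITERION -/

/-- **(c3-i) LEVEL-`c` TUBE CRITERION** (★ TC∕TC′ with a level).  `S` block at `1`, `c ≠ 0`, `M` with tube coordinate `b` and a generator `x₀` (`|x₀,₁|·|ϖ|^b = 1`, so `M = (M ∩ W) + 𝒪x₀`).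
`S·M ⊆ c·M` iff (a) `|S₁₁| ≤ |c|`, (b) `S·(M ∩ W) ⊆ c·M`, (c) `(S − S₁₁)·x₀ ∈ c·M`.  With `S = Γ − u`, `c = 1`: fixedness; `S = Γ − 1`, `c = ϖ^e`: `LEV(ϖ^e)`; `S = (Γ − 1)²`:
`LEV₂`.  No self-duality and no row condition needed. [cite: Kottwitz1986, §3] [cite: BruhatTits1972, §10] -/
theorem forall_mulVec_mem_scaleLattice_iff_of_tubeCoordinate {ϖ : K} (hϖ : Valued.v ϖ = WithZero.exp (-1 : ℤ)) {S : Matrix (Fin 3) (Fin 3) K}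
    (hcol : ∀ l, l ≠ 1 → S l 1 = 0) {c : K} (hc : c ≠ 0)
    {M : Submodule 𝒪[K] (Fin 3 → K)} {b : ℕ} (hb : ∀ a : K, (Pi.single 1 a : Fin 3 → K) ∈ M ↔ Valued.v a ≤ Valued.v ϖ ^ b)
    (hpr : ∀ x ∈ M, Valued.v (x 1) * Valued.v ϖ ^ b ≤ 1) {x₀ : Fin 3 → K} (hx₀ : x₀ ∈ M) (hx₀1 : Valued.v (x₀ 1) * Valued.v ϖ ^ b = 1) :
    (∀ x ∈ M, S *ᵥ x ∈ scaleLattice c M) ↔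
      Valued.v (S 1 1) ≤ Valued.v c ∧ (∀ w ∈ M, w 1 = 0 → S *ᵥ w ∈ scaleLattice c M) ∧ S *ᵥ x₀ - S 1 1 • x₀ ∈ scaleLattice c M := by
  have hϖ0 : Valued.v ϖ ≠ 0 := by rw [hϖ]; exact WithZero.exp_ne_zero
  have hϖb0 : Valued.v ϖ ^ b ≠ 0 := pow_ne_zero _ hϖ0
  have hpos : 0 < Valued.v ϖ ^ b := zero_lt_iff.2 hϖb0
  have hvc : Valued.v c ≠ 0 := (Valuation.ne_zero_iff _).2 hc
  have hx₀v : Valued.v (x₀ 1) = (Valued.v ϖ ^ b)⁻¹ := eq_inv_of_mul_eq_one_left hx₀1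
  have hx₀10 : x₀ 1 ≠ 0 := fun h0 => by rw [h0, map_zero, zero_mul] at hx₀1; exact zero_ne_one hx₀1
  have hmax : ∀ m ∈ M, Valued.v (m 1) ≤ Valued.v (x₀ 1) := fun m hm => by
    rw [hx₀v, ← one_mul (Valued.v ϖ ^ b)⁻¹, le_mul_inv_iff₀ hpos]; exact hpr m hm
  -- `(S₁₁∕c)·y ∈ M` for `y ∈ M` once `|S₁₁| ≤ |c|`
  have hscal : Valued.v (S 1 1) ≤ Valued.v c → ∀ y ∈ M, S 1 1 • y ∈ scaleLattice c M := fun ha y hy => by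
    rw [mem_scaleLattice_iff hc, smul_smul]
    exact smul_mem_of_v_le M (by rw [map_mul, map_inv₀, inv_mul_le_iff₀ (zero_lt_iff.2 hvc), mul_one]; exact ha) hy
  constructor
  · intro h
    have ha : Valued.v (S 1 1) ≤ Valued.v c := by
      have h1 := h _ ((hb (ϖ ^ b)).2 (by rw [map_pow]))
      rw [mulVec_single_one_of_block hcol, mem_scaleLattice_iff hc] at h1
      have e : c⁻¹ • (Pi.single 1 (S 1 1 * ϖ ^ b) : Fin 3 → K) = Pi.single 1 (c⁻¹ * (S 1 1 * ϖ ^ b)) := by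
        ext k; rcases eq_or_ne k 1 with rfl | hk <;> simp [*]
      rw [e, hb, map_mul, map_mul, map_pow, ← mul_assoc] at h1
      have h2 := le_one_of_mul_le_self hϖb0 h1
      rwa [map_inv₀, inv_mul_le_iff₀ (zero_lt_iff.2 hvc), mul_one] at h2
    exact ⟨ha, fun w hw _ => h w hw, Submodule.sub_mem _ (h x₀ hx₀) (hscal ha x₀ hx₀)⟩
  · rintro ⟨ha, hW, hgen⟩ x hx
    obtain ⟨t, ht, htM, ht1⟩ := (mem_iff_exists_sub_smul_mem_of_coord_le 1 hx₀ hx₀10 hmax x).1 hx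
    have e : S *ᵥ x = t • (S *ᵥ x₀ - S 1 1 • x₀) + S 1 1 • (t • x₀) + S *ᵥ (x - t • x₀) := by
      rw [Matrix.mulVec_sub, Matrix.mulVec_smul, smul_sub, smul_comm (S 1 1) t x₀]; abel
    rw [e]
    refine Submodule.add_mem _ (Submodule.add_mem _ (smul_mem_of_v_le _ ht hgen) (hscal ha _ (smul_mem_of_v_le M ht hx₀))) (hW _ htM ht1)

/-! ## §3 (c3-ii) ANATOMY OF A CONE MEMBER -/

/-- **(c3-ii) ANATOMY OF A CONE MEMBER.**  `M` self-dual with tube coordinate `b ≥ 1` and generator `x₀`; `z := ϖ^b·pr_W x₀`.  Then `z ∈ A(M)`; `|⟨z, z⟩| = 1` (the residual line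
of `z` is ANISOTROPIC); `|⟨z,z⟩ + h·σ(ϖ^b x₀,₁)·(ϖ^b x₀,₁)| ≤ |ϖ|^{2b}` (the glued generator is integrally isotropic); and `w ∈ M ∩ W ⟺ w ∈ A(M) ∩ W ∧ |⟨z, w⟩| ≤ |ϖ|^b`.
[cite: Jacobowitz1962, §4] [cite: Kottwitz1986, §3] [cite: BruhatTits1972, §10] -/
theorem cone_anatomy_of_tubeCoordinate (σ : K →+* K) (hvσ : ∀ a, Valued.v (σ a) = Valued.v a)
    {ϖ : K} (hϖ : Valued.v ϖ = WithZero.exp (-1 : ℤ))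
    {H₂ : Matrix (Fin 2) (Fin 2) K} (hH₂ : IsUnit H₂.det) {h : K} (hh : Valued.v h = 1)
    {M : Submodule 𝒪[K] (Fin 3 → K)} (hM : IsSelfDualLattice σ ϖ (!![H₂ 0 0, 0, H₂ 0 1; 0, h, 0; H₂ 1 0, 0, H₂ 1 1] : Matrix (Fin 3) (Fin 3) K) M)
    {b : ℕ} (hb1 : 1 ≤ b) (hb : ∀ a : K, (Pi.single 1 a : Fin 3 → K) ∈ M ↔ Valued.v a ≤ Valued.v ϖ ^ b)
    {x₀ : Fin 3 → K} (hx₀ : x₀ ∈ M) (hx₀1 : Valued.v (x₀ 1) * Valued.v ϖ ^ b = 1) :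
    (ϖ ^ b) • (x₀ - Pi.single 1 (x₀ 1)) ∈ M ⊓ LinearMap.ker ((LinearMap.proj (1 : Fin 3) : (Fin 3 → K) →ₗ[K] K).restrictScalars 𝒪[K]) ⊔ scaleLattice (ϖ ^ b) M ⊔ Submodule.span 𝒪[K] {(Pi.single 1 1 : Fin 3 → K)} ∧
    Valued.v (pairing σ (!![H₂ 0 0, 0, H₂ 0 1; 0, h, 0; H₂ 1 0, 0, H₂ 1 1] : Matrix (Fin 3) (Fin 3) K) ((ϖ ^ b) • (x₀ - Pi.single 1 (x₀ 1))) ((ϖ ^ b) • (x₀ - Pi.single 1 (x₀ 1)))) = 1 ∧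
    Valued.v (pairing σ (!![H₂ 0 0, 0, H₂ 0 1; 0, h, 0; H₂ 1 0, 0, H₂ 1 1] : Matrix (Fin 3) (Fin 3) K) ((ϖ ^ b) • (x₀ - Pi.single 1 (x₀ 1))) ((ϖ ^ b) • (x₀ - Pi.single 1 (x₀ 1))) +
        h * σ (ϖ ^ b * x₀ 1) * (ϖ ^ b * x₀ 1)) ≤ Valued.v ϖ ^ (2 * b) ∧
    (∀ w : Fin 3 → K, w ∈ M ∧ w 1 = 0 ↔
      (w ∈ M ⊓ LinearMap.ker ((LinearMap.proj (1 : Fin 3) : (Fin 3 → K) →ₗ[K] K).restrictScalars 𝒪[K]) ⊔ scaleLattice (ϖ ^ b) M ⊔ Submodule.span 𝒪[K] {(Pi.single 1 1 : Fin 3 → K)} ∧ w 1 = 0 ∧ Valued.v (pairing σ (!![H₂ 0 0, 0, H₂ 0 1; 0, h, 0; H₂ 1 0, 0, H₂ 1 1] : Matrix (Fin 3) (Fin 3) K) ((ϖ ^ b) • (x₀ - Pi.single 1 (x₀ 1))) w) ≤ Valued.v ϖ ^ b)) := by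
  have hHcol : ∀ l : Fin 3, l ≠ 1 → (!![H₂ 0 0, 0, H₂ 0 1; 0, h, 0; H₂ 1 0, 0, H₂ 1 1] : Matrix (Fin 3) (Fin 3) K) l 1 = 0 := fun l hl => endoShapeForm_col H₂ h l hl
  have hHrow : ∀ l : Fin 3, l ≠ 1 → (!![H₂ 0 0, 0, H₂ 0 1; 0, h, 0; H₂ 1 0, 0, H₂ 1 1] : Matrix (Fin 3) (Fin 3) K) 1 l = 0 := fun l hl => endoShapeForm_row H₂ h l hl
  have hH11 : (!![H₂ 0 0, 0, H₂ 0 1; 0, h, 0; H₂ 1 0, 0, H₂ 1 1] : Matrix (Fin 3) (Fin 3) K) 1 1 = h := endoShapeForm_one_one H₂ h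
  have hHdet := isUnit_det_endoShapeForm hH₂ hh
  have hϖ0' : Valued.v ϖ ≠ 0 := by rw [hϖ]; exact WithZero.exp_ne_zero
  have hϖ0 : ϖ ≠ 0 := fun h0 => by rw [h0, map_zero] at hϖ0'; exact hϖ0' rfl
  have hϖ1 : Valued.v ϖ ≤ 1 := by rw [hϖ, ← WithZero.exp_zero, WithZero.exp_le_exp]; omega
  have hϖb0 : Valued.v ϖ ^ b ≠ 0 := pow_ne_zero _ hϖ0'
  have hϖb0' : ϖ ^ b ≠ 0 := pow_ne_zero _ hϖ0
  have hϖb1 : Valued.v (ϖ ^ b) ≤ 1 := by rw [map_pow]; exact pow_le_one₀ zero_le hϖ1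
  have hpos : 0 < Valued.v ϖ ^ b := zero_lt_iff.2 hϖb0
  have hx₀v : Valued.v (x₀ 1) = (Valued.v ϖ ^ b)⁻¹ := eq_inv_of_mul_eq_one_left hx₀1
  have hx₀10 : x₀ 1 ≠ 0 := fun h0 => by rw [h0, map_zero, zero_mul] at hx₀1; exact zero_ne_one hx₀1
  have hσϖb : Valued.v (σ (ϖ ^ b)) = Valued.v ϖ ^ b := by rw [hvσ, map_pow]
  obtain ⟨b', hb', hpr, -⟩ := exists_tubeCoordinate σ hvσ hϖ hH₂ hh hM
  obtain ⟨hbb, -⟩ := tubeCoordinate_unique hϖ hb hb'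
  subst hbb
  have hMd : M ≤ dualLatt σ (!![H₂ 0 0, 0, H₂ 0 1; 0, h, 0; H₂ 1 0, 0, H₂ 1 1] : Matrix (Fin 3) (Fin 3) K) M := le_dualLatt_of_isVertexLattice hvσ hM
  have hMeq : dualLatt σ (!![H₂ 0 0, 0, H₂ 0 1; 0, h, 0; H₂ 1 0, 0, H₂ 1 1] : Matrix (Fin 3) (Fin 3) K) M = M := dualLatt_eq_self_of_isSelfDualLattice hvσ hHdet hM
  have hmax : ∀ m ∈ M, Valued.v (m 1) ≤ Valued.v (x₀ 1) := fun m hm => by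
    rw [hx₀v, ← one_mul (Valued.v ϖ ^ b)⁻¹, le_mul_inv_iff₀ hpos]; exact hpr m hm
  have hw1 : (x₀ - Pi.single 1 (x₀ 1) : Fin 3 → K) 1 = 0 := by simp
  have hEmem : ∀ c : K, Valued.v c ≤ 1 → (Pi.single 1 c : Fin 3 → K) ∈ Submodule.span 𝒪[K] {(Pi.single 1 1 : Fin 3 → K)} := fun c hc => by
    have e : (Pi.single 1 c : Fin 3 → K) = (⟨c, (mem_integer_iff' _).2 hc⟩ : 𝒪[K]) • (Pi.single 1 1 : Fin 3 → K) := by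
      ext k; change _ = (c • (Pi.single 1 1 : Fin 3 → K)) k
      rcases eq_or_ne k 1 with rfl | hk <;> simp [*]
    rw [e]; exact Submodule.smul_mem _ _ (Submodule.mem_span_singleton_self _)
  -- (1) `z ∈ A(M)`
  have h1 : (ϖ ^ b) • (x₀ - Pi.single 1 (x₀ 1)) ∈ M ⊓ LinearMap.ker ((LinearMap.proj (1 : Fin 3) : (Fin 3 → K) →ₗ[K] K).restrictScalars 𝒪[K]) ⊔ scaleLattice (ϖ ^ b) M ⊔ Submodule.span 𝒪[K] {(Pi.single 1 1 : Fin 3 → K)} := by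
    have e : (ϖ ^ b) • (x₀ - Pi.single 1 (x₀ 1)) = (ϖ ^ b) • x₀ - Pi.single 1 (ϖ ^ b * x₀ 1) := by
      ext k; rcases eq_or_ne k 1 with rfl | hk <;> simp [*]
    rw [e]
    refine Submodule.sub_mem _ (Submodule.mem_sup_left (Submodule.mem_sup_right ?_)) (Submodule.mem_sup_right (hEmem _ ?_))
    · rw [mem_scaleLattice_iff hϖb0', smul_smul, inv_mul_cancel₀ hϖb0', one_smul]; exact hx₀
    · rw [map_mul, map_pow, hx₀v, mul_inv_cancel₀ hϖb0]
  -- pairing algebra on the W-part of the generator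
  have hzz : pairing σ (!![H₂ 0 0, 0, H₂ 0 1; 0, h, 0; H₂ 1 0, 0, H₂ 1 1] : Matrix (Fin 3) (Fin 3) K) ((ϖ ^ b) • (x₀ - Pi.single 1 (x₀ 1))) ((ϖ ^ b) • (x₀ - Pi.single 1 (x₀ 1))) =
      σ (ϖ ^ b) * (ϖ ^ b * pairing σ (!![H₂ 0 0, 0, H₂ 0 1; 0, h, 0; H₂ 1 0, 0, H₂ 1 1] : Matrix (Fin 3) (Fin 3) K) x₀ (x₀ - Pi.single 1 (x₀ 1))) := by
    simp only [map_smulₛₗ, LinearMap.smul_apply, RingHom.id_apply, smul_eq_mul]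
    rw [pairing_sub_single_left_of_block σ _ 1 hHrow x₀ hw1]; ring
  have hN := v_pairing_generator_proj σ hvσ hϖ hh hM hb1 hx₀ hx₀1
  have h2 : Valued.v (pairing σ (!![H₂ 0 0, 0, H₂ 0 1; 0, h, 0; H₂ 1 0, 0, H₂ 1 1] : Matrix (Fin 3) (Fin 3) K) ((ϖ ^ b) • (x₀ - Pi.single 1 (x₀ 1))) ((ϖ ^ b) • (x₀ - Pi.single 1 (x₀ 1)))) = 1 := by
    rw [hzz, map_mul, map_mul, hσϖb, map_pow, hN, ← mul_assoc, mul_mul_mul_comm, mul_inv_cancel₀ hϖb0, one_mul]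
  -- (3) the glued generator is integrally isotropic: `⟨pr, pr⟩ + σ(x₀,₁)h x₀,₁ = ⟨x₀, x₀⟩`
  have hself : Valued.v (pairing σ (!![H₂ 0 0, 0, H₂ 0 1; 0, h, 0; H₂ 1 0, 0, H₂ 1 1] : Matrix (Fin 3) (Fin 3) K) x₀ x₀) ≤ 1 := (mem_dualLatt σ _ M x₀).1 (hMd hx₀) x₀ hx₀
  have h3 : Valued.v (pairing σ (!![H₂ 0 0, 0, H₂ 0 1; 0, h, 0; H₂ 1 0, 0, H₂ 1 1] : Matrix (Fin 3) (Fin 3) K) ((ϖ ^ b) • (x₀ - Pi.single 1 (x₀ 1))) ((ϖ ^ b) • (x₀ - Pi.single 1 (x₀ 1))) +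
      h * σ (ϖ ^ b * x₀ 1) * (ϖ ^ b * x₀ 1)) ≤ Valued.v ϖ ^ (2 * b) := by
    have e : pairing σ (!![H₂ 0 0, 0, H₂ 0 1; 0, h, 0; H₂ 1 0, 0, H₂ 1 1] : Matrix (Fin 3) (Fin 3) K) ((ϖ ^ b) • (x₀ - Pi.single 1 (x₀ 1))) ((ϖ ^ b) • (x₀ - Pi.single 1 (x₀ 1))) + h * σ (ϖ ^ b * x₀ 1) * (ϖ ^ b * x₀ 1) =
        σ (ϖ ^ b) * ϖ ^ b * pairing σ (!![H₂ 0 0, 0, H₂ 0 1; 0, h, 0; H₂ 1 0, 0, H₂ 1 1] : Matrix (Fin 3) (Fin 3) K) x₀ x₀ := by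
      rw [hzz, pairing_sub_single_right_of_block σ _ 1 hHcol x₀ x₀, hH11, map_mul]; ring
    rw [e, map_mul, map_mul, hσϖb, map_pow, two_mul, pow_add]
    exact (mul_le_mul' le_rfl hself).trans (le_of_eq (mul_one _))
  refine ⟨h1, h2, h3, fun w => ⟨fun ⟨hwM, hw1'⟩ => ⟨?_, hw1', ?_⟩, fun ⟨hwA, hw1', hzw⟩ => ⟨?_, hw1'⟩⟩⟩
  · exact Submodule.mem_sup_left (Submodule.mem_sup_left ⟨hwM, (mem_kerProj_one_iff w).2 hw1'⟩)
  · rw [map_smulₛₗ, LinearMap.smul_apply, smul_eq_mul, map_mul, hσϖb, pairing_sub_single_left_of_block σ _ 1 hHrow x₀ hw1']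
    exact (mul_le_mul' le_rfl ((mem_dualLatt σ _ M w).1 (hMd hwM) x₀ hx₀)).trans (le_of_eq (mul_one _))
  · -- `w ∈ M^♯ = M`: test against `x₀` and against `M ∩ W`
    have hx₀w : Valued.v (pairing σ (!![H₂ 0 0, 0, H₂ 0 1; 0, h, 0; H₂ 1 0, 0, H₂ 1 1] : Matrix (Fin 3) (Fin 3) K) x₀ w) ≤ 1 := by
      rw [map_smulₛₗ, LinearMap.smul_apply, smul_eq_mul, map_mul, hσϖb, pairing_sub_single_left_of_block σ _ 1 hHrow x₀ hw1'] at hzw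
      exact le_one_of_mul_le_self hϖb0 (by rwa [mul_comm] at hzw)
    have hWw : ∀ w' ∈ M, w' 1 = 0 → Valued.v (pairing σ (!![H₂ 0 0, 0, H₂ 0 1; 0, h, 0; H₂ 1 0, 0, H₂ 1 1] : Matrix (Fin 3) (Fin 3) K) w' w) ≤ 1 := by
      intro w' hw'M hw'1
      obtain ⟨y, hy, l, hl, rfl⟩ := Submodule.mem_sup.1 hwA
      obtain ⟨w₂, hw₂, s, hs, rfl⟩ := Submodule.mem_sup.1 hy
      obtain ⟨a, rfl⟩ := Submodule.mem_span_singleton.1 hl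
      have hs' : s ∈ M := scaleLattice_le_self_of_v_le_one hϖb1 M hs
      have hl0 : pairing σ (!![H₂ 0 0, 0, H₂ 0 1; 0, h, 0; H₂ 1 0, 0, H₂ 1 1] : Matrix (Fin 3) (Fin 3) K) w' (a • (Pi.single 1 1 : Fin 3 → K)) = 0 := by
        have e : a • (Pi.single 1 1 : Fin 3 → K) = Pi.single 1 (a : K) := by
          ext k; change ((a : K) • (Pi.single 1 1 : Fin 3 → K)) k = _
          rcases eq_or_ne k 1 with rfl | hk <;> simp [*]
        rw [e, pairing_single_right_of_block σ _ 1 hHcol, hw'1, map_zero, zero_mul, zero_mul]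
      rw [LinearMap.map_add, LinearMap.map_add, hl0, add_zero]
      exact (Valuation.map_add _ _ _).trans (max_le ((mem_dualLatt σ _ M w₂).1 (hMd hw₂.1) w' hw'M) ((mem_dualLatt σ _ M s).1 (hMd hs') w' hw'M))
    rw [← hMeq, mem_dualLatt]
    intro m hm
    obtain ⟨t, ht, htM, ht1⟩ := (mem_iff_exists_sub_smul_mem_of_coord_le 1 hx₀ hx₀10 hmax m).1 hm
    have e : m = t • x₀ + (m - t • x₀) := (add_sub_cancel (t • x₀) m).symm
    rw [e, map_add, LinearMap.add_apply, map_smulₛₗ, LinearMap.smul_apply, smul_eq_mul]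
    refine (Valuation.map_add _ _ _).trans (max_le ?_ (hWw _ htM ht1))
    rw [map_mul, hvσ]; exact mul_le_one' ht hx₀w

/-! ## §4 (c3-iv′)(c3-iv) LEVELS AND FIXEDNESS OF A BLOCK OPERATOR ON THE CONE, IN GENERATOR CURRENCY -/

omit [Valued K ℤᵐ⁰] in
/-- `(S − S₁₁·1)·v = S·v − S₁₁·v`. [cite: BruhatTits1972, §10] -/
theorem sub_smul_one_mulVec (S : Matrix (Fin 3) (Fin 3) K) (v : Fin 3 → K) :
    (S - S 1 1 • (1 : Matrix (Fin 3) (Fin 3) K)) *ᵥ v = S *ᵥ v - S 1 1 • v := by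
  ext i
  simp [Matrix.mulVec, dotProduct, Fin.sum_univ_three, Matrix.one_apply]
  fin_cases i <;> simp <;> ring

/-- **(c3-iv′) LEVELS ON THE CONE**: for ANY block `T` and level `c ≠ 0`, with `M` self-dual of tube coordinate `b ≥ 1`, generator `x₀`, `z := ϖ^b·pr_W x₀`:
`T·M ⊆ c·M ⟺ |T₁₁| ≤ |c| ∧ T·(M ∩ W) ⊆ c·M ∧ (T − T₁₁)z ∈ (ϖ^b c)·A(M) ∧ |⟨z, (T − T₁₁)z⟩| ≤ |ϖ|^{2b}·|c|`.  With `T = Γ − 1`, `c = ϖ^e` this is `LEV_M(ϖ^e)`; with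
`T = (Γ − 1)²`, `c = ϖ³` it is `LEV₂(ϖ³)`. [cite: Kottwitz1986, §3] [cite: Rogawski1990, §4.9 p. 55] -/
theorem forall_mulVec_mem_scaleLattice_iff_of_cone (σ : K →+* K) (hvσ : ∀ a, Valued.v (σ a) = Valued.v a)
    {ϖ : K} (hϖ : Valued.v ϖ = WithZero.exp (-1 : ℤ))
    {H₂ : Matrix (Fin 2) (Fin 2) K} (hH₂ : IsUnit H₂.det) {h : K} (hh : Valued.v h = 1)
    {M : Submodule 𝒪[K] (Fin 3 → K)} (hM : IsSelfDualLattice σ ϖ (!![H₂ 0 0, 0, H₂ 0 1; 0, h, 0; H₂ 1 0, 0, H₂ 1 1] : Matrix (Fin 3) (Fin 3) K) M)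
    {b : ℕ} (hb1 : 1 ≤ b) (hb : ∀ a : K, (Pi.single 1 a : Fin 3 → K) ∈ M ↔ Valued.v a ≤ Valued.v ϖ ^ b)
    {x₀ : Fin 3 → K} (hx₀ : x₀ ∈ M) (hx₀1 : Valued.v (x₀ 1) * Valued.v ϖ ^ b = 1)
    {S : Matrix (Fin 3) (Fin 3) K} (hcol : ∀ l, l ≠ 1 → S l 1 = 0) (hrow : ∀ l, l ≠ 1 → S 1 l = 0) {c : K} (hc : c ≠ 0) :
    (∀ x ∈ M, S *ᵥ x ∈ scaleLattice c M) ↔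
      Valued.v (S 1 1) ≤ Valued.v c ∧ (∀ w ∈ M, w 1 = 0 → S *ᵥ w ∈ scaleLattice c M) ∧
        (S - S 1 1 • (1 : Matrix (Fin 3) (Fin 3) K)) *ᵥ ((ϖ ^ b) • (x₀ - Pi.single 1 (x₀ 1))) ∈ scaleLattice (ϖ ^ b * c) (M ⊓ LinearMap.ker ((LinearMap.proj (1 : Fin 3) : (Fin 3 → K) →ₗ[K] K).restrictScalars 𝒪[K]) ⊔ scaleLattice (ϖ ^ b) M ⊔ Submodule.span 𝒪[K] {(Pi.single 1 1 : Fin 3 → K)}) ∧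
        Valued.v (pairing σ (!![H₂ 0 0, 0, H₂ 0 1; 0, h, 0; H₂ 1 0, 0, H₂ 1 1] : Matrix (Fin 3) (Fin 3) K) ((ϖ ^ b) • (x₀ - Pi.single 1 (x₀ 1)))
            ((S - S 1 1 • (1 : Matrix (Fin 3) (Fin 3) K)) *ᵥ ((ϖ ^ b) • (x₀ - Pi.single 1 (x₀ 1))))) ≤ Valued.v ϖ ^ (2 * b) * Valued.v c := by
  have hϖ0' : Valued.v ϖ ≠ 0 := by rw [hϖ]; exact WithZero.exp_ne_zero
  have hϖ0 : ϖ ≠ 0 := fun h0 => by rw [h0, map_zero] at hϖ0'; exact hϖ0' rfl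
  have hϖb0 : Valued.v ϖ ^ b ≠ 0 := pow_ne_zero _ hϖ0'
  have hϖb0' : ϖ ^ b ≠ 0 := pow_ne_zero _ hϖ0
  have hvc : Valued.v c ≠ 0 := (Valuation.ne_zero_iff _).2 hc
  obtain ⟨b', hb', hpr, -⟩ := exists_tubeCoordinate σ hvσ hϖ hH₂ hh hM
  obtain ⟨hbb, -⟩ := tubeCoordinate_unique hϖ hb hb'
  subst hbb
  obtain ⟨-, -, -, hanat⟩ := cone_anatomy_of_tubeCoordinate σ hvσ hϖ hH₂ hh hM hb1 hb hx₀ hx₀1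
  rw [forall_mulVec_mem_scaleLattice_iff_of_tubeCoordinate hϖ hcol hc hb hpr hx₀ hx₀1]
  -- the generator clause, read in `W` through the anatomy of `M ∩ W`
  have hy1 : (S *ᵥ x₀ - S 1 1 • x₀) 1 = 0 := sub_smul_mulVec_apply_one_of_block hrow x₀
  have hz : (S - S 1 1 • (1 : Matrix (Fin 3) (Fin 3) K)) *ᵥ ((ϖ ^ b) • (x₀ - Pi.single 1 (x₀ 1))) = (ϖ ^ b) • (S *ᵥ x₀ - S 1 1 • x₀) := by
    rw [sub_smul_one_mulVec, Matrix.mulVec_smul, smul_comm (S 1 1) (ϖ ^ b), ← smul_sub, ← sub_smul_mulVec_eq_of_block hcol]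
  have key : S *ᵥ x₀ - S 1 1 • x₀ ∈ scaleLattice c M ↔
      (S - S 1 1 • (1 : Matrix (Fin 3) (Fin 3) K)) *ᵥ ((ϖ ^ b) • (x₀ - Pi.single 1 (x₀ 1))) ∈ scaleLattice (ϖ ^ b * c) (M ⊓ LinearMap.ker ((LinearMap.proj (1 : Fin 3) : (Fin 3 → K) →ₗ[K] K).restrictScalars 𝒪[K]) ⊔ scaleLattice (ϖ ^ b) M ⊔ Submodule.span 𝒪[K] {(Pi.single 1 1 : Fin 3 → K)}) ∧
        Valued.v (pairing σ (!![H₂ 0 0, 0, H₂ 0 1; 0, h, 0; H₂ 1 0, 0, H₂ 1 1] : Matrix (Fin 3) (Fin 3) K) ((ϖ ^ b) • (x₀ - Pi.single 1 (x₀ 1)))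
            ((S - S 1 1 • (1 : Matrix (Fin 3) (Fin 3) K)) *ᵥ ((ϖ ^ b) • (x₀ - Pi.single 1 (x₀ 1))))) ≤ Valued.v ϖ ^ (2 * b) * Valued.v c := by
    rw [hz, mem_scaleLattice_iff hc, mem_scaleLattice_iff (mul_ne_zero hϖb0' hc), smul_smul, mul_inv_rev, mul_assoc, inv_mul_cancel₀ hϖb0', mul_one,
      LinearMap.map_smul, smul_eq_mul, map_mul, map_pow, two_mul, pow_add, mul_assoc]
    have hsm1 : (c⁻¹ • (S *ᵥ x₀ - S 1 1 • x₀)) 1 = 0 := by rw [Pi.smul_apply, hy1, smul_zero]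
    have hiff := hanat (c⁻¹ • (S *ᵥ x₀ - S 1 1 • x₀))
    have hposc : 0 < Valued.v c := zero_lt_iff.2 hvc
    constructor
    · intro hmem
      obtain ⟨hA, -, hv⟩ := hiff.1 ⟨hmem, hsm1⟩
      refine ⟨hA, ?_⟩
      rw [LinearMap.map_smul, smul_eq_mul, map_mul, map_inv₀, inv_mul_le_iff₀ hposc, mul_comm] at hv
      exact mul_le_mul' le_rfl hv
    · rintro ⟨hA, hv⟩
      refine (hiff.2 ⟨hA, hsm1, ?_⟩).1
      rw [LinearMap.map_smul, smul_eq_mul, map_mul, map_inv₀, inv_mul_le_iff₀ hposc, mul_comm]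
      have h2 := mul_le_mul' (le_refl (Valued.v ϖ ^ b)⁻¹) hv
      rwa [← mul_assoc, inv_mul_cancel₀ hϖb0, one_mul, ← mul_assoc, inv_mul_cancel₀ hϖb0, one_mul] at h2
  rw [key]

/-- **(c3-iv) FIXEDNESS ON THE CONE** (`T = Γ`, `c = 1` in (c3-iv′); `|u| = 1`): `Γ·M ⊆ M ⟺ Γ·(M ∩ W) ⊆ M ∧ (Γ − u)z ∈ ϖ^b·A(M) ∧ |⟨z, (Γ − u)z⟩| ≤ |ϖ|^{2b}` — the gluing
digit never enters; for unitary `Γ` fixing `A(M)` the first clause follows from the other two, and `Γ·M ⊆ M` upgrades to `Γ·M = M` (★ (D1)–(D2)). [cite: Kottwitz1986, §3] [cite: Rogawski1990, §4.9 p. 55] -/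
theorem mapGL_endoGL_le_iff_of_tubeCoordinate (σ : K →+* K) (hvσ : ∀ a, Valued.v (σ a) = Valued.v a)
    {ϖ : K} (hϖ : Valued.v ϖ = WithZero.exp (-1 : ℤ))
    {H₂ : Matrix (Fin 2) (Fin 2) K} (hH₂ : IsUnit H₂.det) {h : K} (hh : Valued.v h = 1)
    {M : Submodule 𝒪[K] (Fin 3 → K)} (hM : IsSelfDualLattice σ ϖ (!![H₂ 0 0, 0, H₂ 0 1; 0, h, 0; H₂ 1 0, 0, H₂ 1 1] : Matrix (Fin 3) (Fin 3) K) M)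
    {b : ℕ} (hb1 : 1 ≤ b) (hb : ∀ a : K, (Pi.single 1 a : Fin 3 → K) ∈ M ↔ Valued.v a ≤ Valued.v ϖ ^ b)
    {x₀ : Fin 3 → K} (hx₀ : x₀ ∈ M) (hx₀1 : Valued.v (x₀ 1) * Valued.v ϖ ^ b = 1)
    (γ₂ : GL (Fin 2) K) {u : GL (Fin 1) K} (hu : Valued.v ((u : Matrix (Fin 1) (Fin 1) K) 0 0) = 1) :
    mapGL (endoGL (γ₂, u)) M ≤ M ↔
      (∀ w ∈ M, w 1 = 0 → ((endoGL (γ₂, u) : GL (Fin 3) K) : Matrix (Fin 3) (Fin 3) K) *ᵥ w ∈ M) ∧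
      ((((endoGL (γ₂, u) : GL (Fin 3) K) : Matrix (Fin 3) (Fin 3) K) - (u : Matrix (Fin 1) (Fin 1) K) 0 0 • (1 : Matrix (Fin 3) (Fin 3) K)) *ᵥ
            ((ϖ ^ b) • (x₀ - Pi.single 1 (x₀ 1))) ∈ scaleLattice (ϖ ^ b) (M ⊓ LinearMap.ker ((LinearMap.proj (1 : Fin 3) : (Fin 3 → K) →ₗ[K] K).restrictScalars 𝒪[K]) ⊔ scaleLattice (ϖ ^ b) M ⊔ Submodule.span 𝒪[K] {(Pi.single 1 1 : Fin 3 → K)}) ∧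
        Valued.v (pairing σ (!![H₂ 0 0, 0, H₂ 0 1; 0, h, 0; H₂ 1 0, 0, H₂ 1 1] : Matrix (Fin 3) (Fin 3) K) ((ϖ ^ b) • (x₀ - Pi.single 1 (x₀ 1)))
            ((((endoGL (γ₂, u) : GL (Fin 3) K) : Matrix (Fin 3) (Fin 3) K) - (u : Matrix (Fin 1) (Fin 1) K) 0 0 • (1 : Matrix (Fin 3) (Fin 3) K)) *ᵥ
              ((ϖ ^ b) • (x₀ - Pi.single 1 (x₀ 1))))) ≤ Valued.v ϖ ^ (2 * b)) := by
  set Γ : Matrix (Fin 3) (Fin 3) K := ((endoGL (γ₂, u) : GL (Fin 3) K) : Matrix (Fin 3) (Fin 3) K) with hΓ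
  have hΓ11 : Γ 1 1 = (u : Matrix (Fin 1) (Fin 1) K) 0 0 := by rw [hΓ, coe_endoGL_eq_endoShape]; rfl
  have hcol : ∀ l : Fin 3, l ≠ 1 → Γ l 1 = 0 := fun l hl => by rw [hΓ, coe_endoGL_eq_endoShape]; fin_cases l <;> simp at hl ⊢
  have hrow : ∀ l : Fin 3, l ≠ 1 → Γ 1 l = 0 := fun l hl => by rw [hΓ, coe_endoGL_eq_endoShape]; fin_cases l <;> simp at hl ⊢
  have key := forall_mulVec_mem_scaleLattice_iff_of_cone σ hvσ hϖ hH₂ hh hM hb1 hb hx₀ hx₀1 hcol hrow one_ne_zero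
  rw [hΓ11, map_one, mul_one, mul_one] at key
  have hM1 : ∀ y : Fin 3 → K, y ∈ scaleLattice (1 : K) M ↔ y ∈ M := fun y => by rw [mem_scaleLattice_iff one_ne_zero, inv_one, one_smul]
  have hle : mapGL (endoGL (γ₂, u)) M ≤ M ↔ ∀ x ∈ M, Γ *ᵥ x ∈ scaleLattice (1 : K) M := by
    constructor
    · intro hle x hx; rw [hM1]; exact hle ⟨x, hx, rfl⟩
    · rintro hall _ ⟨x, hx, rfl⟩; exact (hM1 _).1 (hall x hx)
  rw [hle, key]
  simp only [hM1, hu, le_refl, true_and]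


/-! ## §5 (c3-v) THE VALUE OF THE GLUED GENERATOR -/

omit [Valued K ℤᵐ⁰] in
/-- `(Γ − 1)(z + t·e₁) = (Γ − u)z + (u − 1)z + t(u − 1)·e₁` for `Γ = ι(γ₂, u)`. [cite: Rogawski1990, §4.8 Case (a) p. 53] -/
theorem endoGL_sub_one_mulVec_add_single (γ₂ : GL (Fin 2) K) (u : GL (Fin 1) K) (z : Fin 3 → K) (t : K) :
    ((((endoGL (γ₂, u) : GL (Fin 3) K) : Matrix (Fin 3) (Fin 3) K) - 1) *ᵥ (z + t • (Pi.single 1 1 : Fin 3 → K))) =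
      (((endoGL (γ₂, u) : GL (Fin 3) K) : Matrix (Fin 3) (Fin 3) K) - (u : Matrix (Fin 1) (Fin 1) K) 0 0 • (1 : Matrix (Fin 3) (Fin 3) K)) *ᵥ z +
        ((u : Matrix (Fin 1) (Fin 1) K) 0 0 - 1) • z + (t * ((u : Matrix (Fin 1) (Fin 1) K) 0 0 - 1)) • (Pi.single 1 1 : Fin 3 → K) := by
  have e1 : t • (Pi.single 1 1 : Fin 3 → K) = Pi.single 1 t := by
    ext k; rcases eq_or_ne k 1 with rfl | hk <;> simp [*]
  rw [Matrix.mulVec_add, e1, Matrix.sub_mulVec, Matrix.sub_mulVec, Matrix.one_mulVec, Matrix.one_mulVec, endoGL_mulVec_single_one,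
    Matrix.sub_mulVec, Matrix.smul_mulVec, Matrix.one_mulVec]
  have e2 : (Pi.single 1 ((u : Matrix (Fin 1) (Fin 1) K) 0 0 * t) : Fin 3 → K) - Pi.single 1 t = (t * ((u : Matrix (Fin 1) (Fin 1) K) 0 0 - 1)) • (Pi.single 1 1 : Fin 3 → K) := by
    ext k; rcases eq_or_ne k 1 with rfl | hk
    · simp; ring
    · simp [hk]
  rw [e2]; module

omit [Valued K ℤᵐ⁰] in
/-- **(c3-v) VALUE OF THE GLUED GENERATOR**: for `z ∈ W`, `t ∈ K` and `Γ = ι(γ₂, u)`: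
`⟨z + t·e₁, (Γ − 1)(z + t·e₁)⟩ = ⟨z, (Γ − u)z⟩ + (u − 1)·(⟨z, z⟩ + σ(t)·h·t)` — on the cone (`x₀ = ϖ^{-b}(z + te₁)`, `⟨z,z⟩ + hN(t) ∈ ϖ^{2b}𝒪`) the value of the generator
is `⟨z, (Γ − u)z⟩` up to `(u − 1)ϖ^{2b}𝒪`, and `σ(ϖ^b)⁻¹ϖ^{-b}` rescales it (∘ ★ p847504 for the other generators). [cite: Kottwitz1986, §3] [cite: Rogawski1990, §4.9 p. 55] -/
theorem pairing_add_single_endoGL_sub_one (σ : K →+* K) (H₂ : Matrix (Fin 2) (Fin 2) K) (h : K)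
    {z : Fin 3 → K} (hz1 : z 1 = 0) (t : K) (γ₂ : GL (Fin 2) K) (u : GL (Fin 1) K) :
    pairing σ (!![H₂ 0 0, 0, H₂ 0 1; 0, h, 0; H₂ 1 0, 0, H₂ 1 1] : Matrix (Fin 3) (Fin 3) K) (z + t • (Pi.single 1 1 : Fin 3 → K))
        ((((endoGL (γ₂, u) : GL (Fin 3) K) : Matrix (Fin 3) (Fin 3) K) - 1) *ᵥ (z + t • (Pi.single 1 1 : Fin 3 → K))) =
      pairing σ (!![H₂ 0 0, 0, H₂ 0 1; 0, h, 0; H₂ 1 0, 0, H₂ 1 1] : Matrix (Fin 3) (Fin 3) K) z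
          ((((endoGL (γ₂, u) : GL (Fin 3) K) : Matrix (Fin 3) (Fin 3) K) - (u : Matrix (Fin 1) (Fin 1) K) 0 0 • (1 : Matrix (Fin 3) (Fin 3) K)) *ᵥ z) +
        ((u : Matrix (Fin 1) (Fin 1) K) 0 0 - 1) * (pairing σ (!![H₂ 0 0, 0, H₂ 0 1; 0, h, 0; H₂ 1 0, 0, H₂ 1 1] : Matrix (Fin 3) (Fin 3) K) z z + σ t * h * t) := by
  have hHcol : ∀ l : Fin 3, l ≠ 1 → (!![H₂ 0 0, 0, H₂ 0 1; 0, h, 0; H₂ 1 0, 0, H₂ 1 1] : Matrix (Fin 3) (Fin 3) K) l 1 = 0 := fun l hl => endoShapeForm_col H₂ h l hl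
  have hHrow : ∀ l : Fin 3, l ≠ 1 → (!![H₂ 0 0, 0, H₂ 0 1; 0, h, 0; H₂ 1 0, 0, H₂ 1 1] : Matrix (Fin 3) (Fin 3) K) 1 l = 0 := fun l hl => endoShapeForm_row H₂ h l hl
  have hH11 : (!![H₂ 0 0, 0, H₂ 0 1; 0, h, 0; H₂ 1 0, 0, H₂ 1 1] : Matrix (Fin 3) (Fin 3) K) 1 1 = h := endoShapeForm_one_one H₂ h
  have e1 : t • (Pi.single 1 1 : Fin 3 → K) = Pi.single 1 t := by
    ext k; rcases eq_or_ne k 1 with rfl | hk <;> simp [*]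
  -- the W-vector `(Γ − u)z` has no `e₁`-component
  have hw1 : (((((endoGL (γ₂, u) : GL (Fin 3) K) : Matrix (Fin 3) (Fin 3) K) - (u : Matrix (Fin 1) (Fin 1) K) 0 0 • (1 : Matrix (Fin 3) (Fin 3) K)) *ᵥ z) : Fin 3 → K) 1 = 0 := by
    rw [Matrix.sub_mulVec, Matrix.smul_mulVec, Matrix.one_mulVec, Pi.sub_apply, endoGL_mulVec_apply_one, Pi.smul_apply, smul_eq_mul, hz1, mul_zero, sub_self]
  rw [endoGL_sub_one_mulVec_add_single, e1]
  simp only [map_add, LinearMap.add_apply, map_smulₛₗ, smul_eq_mul, RingHom.id_apply]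
  rw [pairing_single_left_of_block σ _ 1 hHrow t, pairing_single_left_of_block σ _ 1 hHrow t z, pairing_single_left_of_block σ _ 1 hHrow t,
    pairing_single_right_of_block σ _ 1 hHcol z, hw1, hz1, hH11, Pi.single_eq_same, map_zero]
  ring

end Literature.NumberTheory.Automorphic.UnitaryLatticeTree

end
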